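import Mathlib
import Literature.Analysis.FluidPDE.SelfSimilarEulerProfileVorticity
import Literature.Analysis.FluidPDE.VectorCalculusProofs
import Summits.NavierStokesRegularity.NavierStokesRegularity.Theorems.EulerZoomLiouvillePowerGaugeEulerLiouvilleSelfSimilarPastStrata
import Summits.NavierStokesRegularity.NavierStokesRegularity.Theorems.EulerZoomLiouvillePowerGaugeEulerLiouvilleBirthDefs
import Summits.NavierStokesRegularity.NavierStokesRegularity.Theorems.SwirlHolderTowerFunnelDrift
import HarnessLib

/-!
# Crux `EulerZoomLiouville.PowerGaugeEulerLiouville` (stmt-NavierStokesRegularity-19832), THE ONE STATEMENT `stub_selfSimilarC2Needle`: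
# NO FORCE-FREE (BELTRAMI) NEEDLE — a `C²` self-similar Euler collapse profile whose vorticity is everywhere parallel to the
# velocity, `curl V = λ V` with a differentiable factor `λ`, is IRROTATIONAL, hence the member is trivial

Helper file (theorems only; `--supports stmt-NavierStokesRegularity-19832`; def-free).  Hand leafhand-ns-eulerzoomliouville-10 g1.

The open needle of the skeleton of record (`Cruxes/PowerGaugeEulerLiouville/Lines/birth.lean` v119, `Sig.stub_selfSimilarC2Needle`) is an
exactly self-similar member `u(τ,x) = (−τ)^{γ−1} V((−τ)^{−γ}x)`, `γ = 1/(2+ρ)`, with an extremal `C²` profile `V` that is NOT sub-drift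
(`limsup ‖V(y)‖/‖y‖ ≥ γ` along sparse fast spikes — `…SelfSimilarSubdriftLoc`), has no axis of symmetry, no clock, no channel …; its
chirality is unconstrained a priori (the helicity lane `…SelfSimilarHelicity` / `…Negative.SelfSimilarHelicityFree` only forces `∫⟪V, curl V⟫ = 0`
under flux budgets).  This file closes the OPPOSITE, maximally chiral corner exactly: the FORCE-FREE profiles of classical steady-Euler
type (Arnold's Beltrami fields, `curl V = λ V`), for which the Lamb vector `curl V × V` vanishes identically.

* `Beltrami.eq_zero_of_add_smul_fderiv_self` — EULER-HOMOGENEITY KILL (any real normed spaces): a differentiable field `Ω` with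
  `Ω(y) + γ DΩ(y)[y] = 0` for all `y`, `γ > 0`, vanishes identically (`Ω` is positively homogeneous of degree `−1/γ < 0` along rays,
  `Ω(e^t y) = e^{−t/γ} Ω(y)`, and continuous at the origin where `Ω(0) = 0`).
* `Beltrami.curl_eq_zero_of_curl_eq_smul` — PROFILE LEVEL: for a `C²` self-similar Euler profile `(V, P)` (CIV (3.3),
  `IsSelfSimilarEulerProfile γ 0 V P`) with `γ > 0` and `curl V = λ • V`, `λ` differentiable: `curl V ≡ 0`.  Proof: `div curl V = 0` and
  `div V = 0` give `Dλ[V] = 0`; then in the vorticity form CIV (3.4), `Ω + DΩ[γy + V] = DV[Ω]` (`IsSelfSimilarEulerProfile.isSelfSimilarEulerVorticityProfile`),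
  the two nonlinear terms are both `λ DV[V]` and cancel, leaving `Ω + γ DΩ[y] = 0`; the homogeneity kill ends it.  (No growth, decay,
  extremality or symmetry hypothesis; every `γ > 0`.)
* `Loc.selfSimilar_ae_eq_zero_of_beltramiC2_profile` — MEMBER LEVEL (crux hypotheses: distributional Euler pair on the slab + the `A`-gauge;
  exact self-similarity about the origin; `V ∈ C²`; `curl V = λ • V`): `u = 0` a.e. — the classical pressure of `Past.exists_isSelfSimilarEulerProfile`,
  the profile-level kill, and the lineage's irrotational endgame `Loc.selfSimilar_ae_eq_zero_of_irrotationalC2_profile` (harmonic Liouville under the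
  `A`-gauge growth `∫_{B_L}‖V‖² ≤ cL^{1−2ρ}`).
* `Birth.selfSimilarC2Needle_of_beltrami` — the same in the binder language of the skeleton (`InClass`, `IsExactlySelfSimilar`): the force-free
  sub-stratum of `stub_selfSimilarC2Needle` is closed for every `0 < ρ` (no window restriction).

WHAT THIS IS NOT: not a proof of the stub, the crux, or the route; nothing about Navier–Stokes; the generic needle (`curl V` not parallel to `V`)
is untouched.  [folklore; ConstantinIgnatovaVicol2026Putative §3.1.1 (3.3)–(3.4) (profile and vorticity equations);
ArnoldKhesin1998 §II.1 (Beltrami / force-free fields as steady Euler flows)]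
-/

noncomputable section

-- flat `Theorems/<Route><Decl>…` files of one crux share the namespace of the crux (tree convention)
set_option linter.dupNamespace false

open MeasureTheory Set Filter Topology Metric Function
open scoped RealInnerProductSpace NNReal ENNReal ContDiff

namespace Summit.NavierStokesRegularity.NavierStokesRegularity.Theorems.PowerGaugeEulerLiouville

open Literature.Analysis Literature.Analysis.FluidPDE

namespace Beltrami

/-! ### The Euler-homogeneity kill -/

section Homogeneity

variable {E F : Type*} [NormedAddCommGroup E] [NormedSpace ℝ E] [NormedAddCommGroup F] [NormedSpace ℝ F]

/-- **Euler-homogeneity kill.**  A differentiable field `Ω : E → F` with `Ω(y) + γ • DΩ(y)[y] = 0` for every `y`, `γ > 0`, is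
identically zero: along each ray `t ↦ e^t y` one has `d/dt Ω(e^t y) = DΩ(e^t y)[e^t y] = −γ⁻¹ Ω(e^t y)`, so
`Ω(e^t y) = e^{−t/γ} Ω(y)`; as `t → −∞` the left side tends to `Ω(0) = 0` (the relation at `y = 0`) while `e^{−t/γ} → +∞`.
[folklore] -/
theorem eq_zero_of_add_smul_fderiv_self {Ω : E → F} (hΩ : Differentiable ℝ Ω) {γ : ℝ} (hγ : 0 < γ)
    (h : ∀ y, Ω y + γ • fderiv ℝ Ω y y = 0) : Ω = 0 := by
  have hγ0 : γ ≠ 0 := hγ.ne'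
  -- the relation at the origin
  have hΩ0 : Ω 0 = 0 := by simpa using h 0
  -- directional derivative along the position vector
  have hdir : ∀ z : E, fderiv ℝ Ω z z = -(γ⁻¹ • Ω z) := by
    intro z
    have hz := h z
    have : γ • fderiv ℝ Ω z z = -Ω z := by
      rw [← add_eq_zero_iff_eq_neg.1 (by rwa [add_comm] at hz)]
    calc fderiv ℝ Ω z z = γ⁻¹ • (γ • fderiv ℝ Ω z z) := by rw [smul_smul, inv_mul_cancel₀ hγ0, one_smul]
      _ = -(γ⁻¹ • Ω z) := by rw [this, smul_neg]
  funext y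
  -- the ray function `G t = e^{t/γ} • Ω (e^t • y)` is constant
  set G : ℝ → F := fun t => Real.exp (t / γ) • Ω (Real.exp t • y) with hG
  have hray : ∀ t : ℝ, HasDerivAt (fun s : ℝ => Real.exp s • y) (Real.exp t • y) t :=
    fun t => (Real.hasDerivAt_exp t).smul_const y
  have hg : ∀ t : ℝ, HasDerivAt (fun s : ℝ => Ω (Real.exp s • y))
      (fderiv ℝ Ω (Real.exp t • y) (Real.exp t • y)) t :=
    fun t => (hΩ (Real.exp t • y)).hasFDerivAt.comp_hasDerivAt t (hray t)
  have hexp : ∀ t : ℝ, HasDerivAt (fun s : ℝ => Real.exp (s / γ)) (Real.exp (t / γ) * (1 / γ)) t := by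
    intro t
    have h1 : HasDerivAt (fun s : ℝ => s / γ) (1 / γ) t := by
      simpa using (hasDerivAt_id t).div_const γ
    have h2 := (Real.hasDerivAt_exp (t / γ)).comp t h1
    simpa [Function.comp_def] using h2
  have hG' : ∀ t : ℝ, HasDerivAt G 0 t := by
    intro t
    have hprod := (hexp t).smul (hg t)
    have hzero : Real.exp (t / γ) • fderiv ℝ Ω (Real.exp t • y) (Real.exp t • y) +
        (Real.exp (t / γ) * (1 / γ)) • Ω (Real.exp t • y) = 0 := by
      rw [hdir, smul_neg, one_div, mul_smul, neg_add_cancel]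
    rw [hzero] at hprod
    exact hprod
  have hGconst : ∀ t : ℝ, G t = G 0 := by
    intro t
    have hdiff : Differentiable ℝ G := fun s => (hG' s).differentiableAt
    exact is_const_of_deriv_eq_zero hdiff (fun s => (hG' s).deriv) t 0
  have hG0 : G 0 = Ω y := by simp [hG]
  -- hence `Ω (e^t • y) = e^{−t/γ} • Ω y`
  have hformula : ∀ t : ℝ, Ω (Real.exp t • y) = Real.exp (-(t / γ)) • Ω y := by
    intro t
    have ht := hGconst t
    rw [hG0] at ht
    have : Real.exp (-(t / γ)) • G t = Ω (Real.exp t • y) := by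
      simp only [hG, smul_smul, ← Real.exp_add, neg_add_cancel, Real.exp_zero, one_smul]
    rw [← this, ht]
  -- the left side tends to `Ω 0 = 0` as `t → −∞`
  have hlim0 : Tendsto (fun t : ℝ => Ω (Real.exp t • y)) atBot (𝓝 0) := by
    have h1 : Tendsto (fun t : ℝ => Real.exp t • y) atBot (𝓝 ((0 : ℝ) • y)) :=
      Real.tendsto_exp_atBot.smul_const y
    rw [zero_smul] at h1
    have h2 := (hΩ.continuous.tendsto 0).comp h1
    rwa [hΩ0] at h2
  -- so `e^{−t/γ} ‖Ω y‖ → 0`, forcing `Ω y = 0`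
  by_contra hy
  have hpos : 0 < ‖Ω y‖ := norm_pos_iff.2 hy
  have hnorm : Tendsto (fun t : ℝ => Real.exp (-(t / γ)) * ‖Ω y‖) atBot (𝓝 0) := by
    have := (tendsto_norm_zero.comp hlim0)
    refine this.congr fun t => ?_
    simp only [Function.comp_apply, hformula t, norm_smul, Real.norm_eq_abs, abs_of_pos (Real.exp_pos _)]
  have hup : Tendsto (fun t : ℝ => Real.exp (-(t / γ)) * ‖Ω y‖) atBot atTop := by
    have h1 : Tendsto (fun t : ℝ => -(t / γ)) atBot atTop := by
      have : Tendsto (fun t : ℝ => t / γ) atBot atBot := tendsto_id.atBot_div_const hγ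
      exact tendsto_neg_atBot_atTop.comp this
    exact (Real.tendsto_exp_atTop.comp h1).atTop_mul_const hpos
  exact not_tendsto_atTop_of_tendsto_nhds hnorm hup

end Homogeneity

/-! ### Profile level: a force-free `C²` self-similar Euler profile is irrotational -/

variable {γ : ℝ} {U : EuclideanSpace ℝ (Fin 3) → EuclideanSpace ℝ (Fin 3)} {P : EuclideanSpace ℝ (Fin 3) → ℝ}

/-- **A FORCE-FREE `C²` SELF-SIMILAR EULER PROFILE IS IRROTATIONAL** (every `γ > 0`).  If `(U, P)` solves CIV (3.3) classically and
`curl U = λ • U` with `λ` differentiable, then `curl U ≡ 0`: `div (curl U) = 0 = div U` give `Dλ[U] = 0` (product rule `SwirlHolderTower.divergence_smul_pt`), so with `Ω = curl U = λU` one has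
`DΩ[U] = Dλ[U] U + λ DU[U] = λ DU[U] = DU[Ω]`, and the vorticity form CIV (3.4) `Ω + DΩ[γy + U] = DU[Ω]` collapses to `Ω + γ DΩ[y] = 0`;
`eq_zero_of_add_smul_fderiv_self` concludes. [folklore; ConstantinIgnatovaVicol2026Putative §3.1.1 (3.4)] -/
theorem curl_eq_zero_of_curl_eq_smul (hprof : IsSelfSimilarEulerProfile γ 0 U P) (hγ : 0 < γ)
    {lam : EuclideanSpace ℝ (Fin 3) → ℝ} (hlam : Differentiable ℝ lam) (hB : ∀ y, curl U y = lam y • U y) :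
    ∀ y, curl U y = 0 := by
  have hU2 : ContDiff ℝ 2 U := hprof.contDiff_velocity
  have hUd : Differentiable ℝ U := hprof.differentiable_velocity
  have hΩd : Differentiable ℝ (curl U) := differentiable_curl_of_contDiff hU2
  have hfun : curl U = fun y => lam y • U y := funext hB
  -- `Dλ[U] = 0` from `div curl U = 0` and `div U = 0`
  have hDlam : ∀ y, fderiv ℝ lam y (U y) = 0 := by
    intro y
    have h1 : VectorCalculus.divergence (curl U) y = 0 := divergence_curl_eq_zero_holds U hU2 y
    rw [hfun, SwirlHolderTower.divergence_smul_pt (hlam y) (hUd y), hprof.divFree y, mul_zero, zero_add] at h1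
    exact h1
  -- the derivative of `Ω = λ • U`
  have hDΩ : ∀ y h, fderiv ℝ (curl U) y h = lam y • fderiv ℝ U y h + fderiv ℝ lam y h • U y := by
    intro y h
    rw [hfun, fderiv_fun_smul (hlam y) (hUd y)]
    simp only [_root_.add_apply, _root_.FunLike.coe_smul, Pi.smul_apply, ContinuousLinearMap.smulRight_apply]
  -- the vorticity equation collapses to `Ω + γ DΩ[y] = 0`
  have hkey : ∀ y, curl U y + γ • fderiv ℝ (curl U) y y = 0 := by
    intro y
    have hv := hprof.isSelfSimilarEulerVorticityProfile.vorticity_eq y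
    rw [sub_zero, map_add, map_smul, hDΩ y (U y), hDlam y, zero_smul, add_zero, hB y, map_smul] at hv
    -- hv : λ•U + (γ•DΩ y + λ•DU(U)) = λ•DU(U)
    have : lam y • U y + γ • fderiv ℝ (curl U) y y = 0 := by
      have := sub_eq_zero.2 hv
      rw [← this]
      abel
    rwa [hB y]
  have hzero := eq_zero_of_add_smul_fderiv_self hΩd hγ hkey
  exact fun y => congrFun hzero y

/-- **Strong Beltrami profiles** (`curl U = λ • U` with a CONSTANT `λ`) are irrotational. [folklore] -/
theorem curl_eq_zero_of_curl_eq_const_smul (hprof : IsSelfSimilarEulerProfile γ 0 U P) (hγ : 0 < γ)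
    {lam : ℝ} (hB : ∀ y, curl U y = lam • U y) : ∀ y, curl U y = 0 :=
  curl_eq_zero_of_curl_eq_smul hprof hγ (lam := fun _ => lam) (differentiable_const lam) hB

end Beltrami

/-! ### Member level -/

/-- **EXACTLY SELF-SIMILAR MEMBERS WITH A FORCE-FREE `C²` PROFILE ARE TRIVIAL** (every `ρ > 0`).  Let `(u, p)` be a distributional Euler pair on
`(−∞,0) × ℝ³` with `a^{2ρ} A(a; 0) ≤ c` for all `a > 0`, exactly self-similar about the origin with the class exponent `γ = 1/(2+ρ)` and profile
`(V, P)`, `V ∈ C²`, and suppose `curl V = λ • V` for a differentiable `λ`.  Then `u = 0` a.e. on the slab: CIV (3.3) holds classically for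
some `C¹` pressure (`Past.exists_isSelfSimilarEulerProfile`), `curl V ≡ 0` (`Beltrami.curl_eq_zero_of_curl_eq_smul`), and the irrotational
endgame `Loc.selfSimilar_ae_eq_zero_of_irrotationalC2_profile` applies. [folklore] -/
theorem Loc.selfSimilar_ae_eq_zero_of_beltramiC2_profile {ρ : ℝ} (hρ : 0 < ρ)
    {u : ℝ → EuclideanSpace ℝ (Fin 3) → EuclideanSpace ℝ (Fin 3)} {p : ℝ → EuclideanSpace ℝ (Fin 3) → ℝ} {c : ℝ≥0}
    (hsol : IsDistributionalNSSolutionOn (slab (EuclideanSpace ℝ (Fin 3)) (Iio 0) isOpen_Iio) 0 0 u p)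
    (hA : ∀ a : ℝ, 0 < a → ENNReal.ofReal (a ^ (2 * ρ)) *
      cknA a (0 : ℝ × EuclideanSpace ℝ (Fin 3)) u ≤ (c : ℝ≥0∞))
    {V : EuclideanSpace ℝ (Fin 3) → EuclideanSpace ℝ (Fin 3)} {P : EuclideanSpace ℝ (Fin 3) → ℝ}
    (hu : ∀ τ : ℝ, τ < 0 → u τ = selfSimilarCollapse (1 / (2 + ρ)) 0 V τ)
    (hp : ∀ τ : ℝ, τ < 0 → p τ = selfSimilarCollapsePressure (1 / (2 + ρ)) 0 P τ)
    (hV : ContDiff ℝ 2 V) {lam : EuclideanSpace ℝ (Fin 3) → ℝ} (hlam : Differentiable ℝ lam)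
    (hB : ∀ y, curl V y = lam y • V y) :
    uncurry u =ᵐ[volume.restrict (Iio (0 : ℝ) ×ˢ (univ : Set (EuclideanSpace ℝ (Fin 3))))] 0 := by
  have h2ρ : (0 : ℝ) < 2 + ρ := by linarith
  have hγ : (0 : ℝ) < 1 / (2 + ρ) := one_div_pos.2 h2ρ
  -- the classical profile equation (past-exact form about `(0, 0)` with `T₁ = 0`)
  have hu' : ∀ τ : ℝ, τ < 0 → u τ = fun x => selfSimilarCollapse (1 / (2 + ρ)) 0 V τ (x - 0) :=
    fun τ hτ => by rw [hu τ hτ]; funext x; rw [sub_zero]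
  have hp' : ∀ τ : ℝ, τ < 0 → p τ = fun x => selfSimilarCollapsePressure (1 / (2 + ρ)) 0 P τ (x - 0) :=
    fun τ hτ => by rw [hp τ hτ]; funext x; rw [sub_zero]
  obtain ⟨P', hprof⟩ := Past.exists_isSelfSimilarEulerProfile (T := 0) (T₁ := 0) (x₀ := 0) hρ le_rfl le_rfl hsol hu' hp' hV
  have hcurl : ∀ y, curl V y = 0 := Beltrami.curl_eq_zero_of_curl_eq_smul hprof hγ hlam hB
  exact Loc.selfSimilar_ae_eq_zero_of_irrotationalC2_profile hρ hsol hA hu hV hcurl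

/-- **THE FORCE-FREE SUB-STRATUM OF `stub_selfSimilarC2Needle` IS CLOSED** (binder language of the skeleton of record, every `0 < ρ`): a member
of the class (`Birth.InClass ρ u p H c`), exactly self-similar about the origin (`Birth.IsExactlySelfSimilar ρ u p V P`) with `V ∈ C²` and
`curl V = λ • V` for some differentiable `λ`, is trivial.  Only the distributional Euler identity and the `A`-gauge of the class are used. [folklore] -/
theorem Birth.selfSimilarC2Needle_of_beltrami :
    ∀ ρ : ℝ, 0 < ρ →
      ∀ (u : ℝ → EuclideanSpace ℝ (Fin 3) → EuclideanSpace ℝ (Fin 3)) (p : ℝ → EuclideanSpace ℝ (Fin 3) → ℝ)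
        (H : ℝ → EuclideanSpace ℝ (Fin 3) → EuclideanSpace ℝ (Fin 3) →L[ℝ] EuclideanSpace ℝ (Fin 3)) (c : ℝ≥0)
        (V : EuclideanSpace ℝ (Fin 3) → EuclideanSpace ℝ (Fin 3)) (P : EuclideanSpace ℝ (Fin 3) → ℝ),
        Birth.InClass ρ u p H c → Birth.IsExactlySelfSimilar ρ u p V P → ContDiff ℝ 2 V →
          (∃ lam : EuclideanSpace ℝ (Fin 3) → ℝ, Differentiable ℝ lam ∧ ∀ y, curl V y = lam y • V y) →
          uncurry u =ᵐ[volume.restrict (Iio (0 : ℝ) ×ˢ (univ : Set (EuclideanSpace ℝ (Fin 3))))] 0 := by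
  intro ρ hρ u p H c V P hcl hss hV hB
  obtain ⟨hsw, -, hgauge⟩ := hcl
  obtain ⟨lam, hlam, hB⟩ := hB
  have hA : ∀ a : ℝ, 0 < a → ENNReal.ofReal (a ^ (2 * ρ)) *
      cknA a (0 : ℝ × EuclideanSpace ℝ (Fin 3)) u ≤ (c : ℝ≥0∞) :=
    fun a ha => le_trans (le_trans le_self_add le_self_add) (hgauge a ha)
  exact Loc.selfSimilar_ae_eq_zero_of_beltramiC2_profile hρ hsw.distributional hA hss.1 hss.2 hV hlam hB

end Summit.NavierStokesRegularity.NavierStokesRegularity.Theorems.PowerGaugeEulerLiouville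

end
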